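/-
Copyright (c) 2026 the pub-hodgecm-mathlib formalisation cell (harness21).  Prover seat hodgecm-mathlib-LH4-p02 (g12): STAGE 1a «(D-RAM) FOUR-FRAME» road,
tier-1 module `U4_Rows` §2 (iv-a)·T3 (dealer LH4-plan (g10) WORD #24): the REGULAR diagonal witness of `stub_U4_table_diag_ne_zero`; 2026-09-03.
-/
import Summits.HodgeConjecture.HodgeConjecture.Theorems.F0P3cDyRamUnipotentLabelInjOn        -- ★ p854790 (this seat): `isConj_of_conj_conj_eq`, `wMatrix_sub_one_pow_eq_zero`, `galAdicCompletionMap_involutive_and_two_ne_zero`; brings ★ T1 inputs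
import Summits.HodgeConjecture.HodgeConjecture.Theorems.F0P3cDyRamDOfPlaceOfDatum            -- ★ p854662 (this seat): `dOfPlace_eq_of_isRamifiedQuadraticDatum`
import Literature.NumberTheory.LocalFields.WildQuadraticDatumNormSurjective                     -- ★ p854729 (this seat): `WildQuadraticDatum.exists_traceOne_of_datum`
import Literature.NumberTheory.Automorphic.UnitaryLevelTwoInteriorRelabel                       -- ★ `mem_cmLocalIntegralLevel_iff_isIntMatrix` (`u ∈ K ↔ ψ u, (ψ u)⁻¹ integral`)
import HarnessLib

/-!
# Crux `H413`, line LH4 «(D-RAM) FOUR-FRAME», module `U4_Rows` §2 (iv-a)·T3: the REGULAR DIAGONAL WITNESS — an integral regular unipotent of `K = U(Φ₃)(𝒪_v)` whose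
# `X²` is NOT in `ϖ^{m*}M₃(𝒪_w)`, in every regular unipotent class

Cell `hodgecm-mathlib` (D-0151), FLOOR 0, crux item H413 = `stmt-HodgeConjecture-24833`, route of record `HCCMUnconditional`; squad F0∕P3c∕LH4 Track A; dealer
LH4-plan (g10) WORD #24 (T3 `stub_U4_table_diag_ne_zero` → this seat).  THEOREMS ONLY (no `def`, no instance, no notation, no `sorry`, default heartbeats); lane
`--supports stmt-HodgeConjecture-24833 --as helper`.

WHAT IS PROVED.  `exists_mem_supportReg_mk_eq`: at a ramified `σ`-stable place with uniformizer `ϖ`, every conjugacy class `c` of `G = U(Φ₃)(L⁺_v)` whose representative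
is a REGULAR unipotent (`(u − 1)³ = 0`, `(wMatrix u − 1)² ≠ 0`) MEETS the support set of the piece `f_reg` of ★ №3: there is `x ∈ K = cmLocalIntegralLevel` with
`(wMatrix x − 1)² ∉ ϖ^{m*}·M₃(𝒪_w)` and `ConjClasses.mk x = c`.  THE WITNESS (REF5 R5-11 (T3); at a WILD place `u(1, −½) ∉ K`, so one goes down to depth `k = ⌊d∕2⌋`):
`g = u(ϖ^k, b) = (1, ϖ^k, b; 0, 1, −σϖ^k; 0, 0, 1)` with `b = −θ·ϖ^kσϖ^k`, `θ` the TRACE-ONE element of the datum (`θ + σθ = 1`, `|θ|·|ϖ|^d = |ϖ|`, ★ p854729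
`exists_traceOne_of_datum`), so that `b + σb + ϖ^kσϖ^k = 0` (★ `mem_unitaryGroupOfForm_iff_of_coe_eq_upperUnipotent`) and `|b| = |ϖ|^{ℓ₀' }`, `ℓ₀' = 1 − d % 2 ≥ 0`
(integral); `g` and `g⁻¹` are integral (★ `exists_units_coe_eq_upperTriangularUnipotent`), so `x = ψ⁻¹(g) ∈ K` (★ `exists_conj_localNonsplitEquiv_eq`,
★ `mem_cmLocalIntegralLevel_iff_isIntMatrix`); `(g − 1)² = −ϖ^kσϖ^k·E₁₃` (★ `upperUnipotent_sub_one_mul_self`) has valuation `2k = d − ℓ₀ < m* = ℓ₀ + 2d − 1`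
(`d = dOfPlace`, ★ p854662), so `(g − 1)² ∉ ϖ^{m*}M₃(𝒪)` and `g` is regular; ONE regular class (★ `exists_conj_coe_eq_regularUnipotentNormalForm`, Rogawski 3.9.1, via
★ T1 `isConj_of_conj_conj_eq`) gives `x ~ out c`.

HONEST LABEL.  Count-neutral helper (`--supports 24833`) feeding the T3 payer.  (D-RAM) verdict of record PRINT [LanglandsShelstad1989 Thm. p. 484 ∕ Rogawski1990
Prop. 4.9.1 (a)] ∕ XL; `HC_CM` is proved only modulo the 7 printed citations (2 remaining: hLiu418 = `stmt-HodgeConjecture-24832`, h413 = `stmt-HodgeConjecture-24833`)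
until rung 0 closes.

## References
* [Rogawski1990] J. D. Rogawski, *Automorphic Representations of Unitary Groups in Three Variables*, Ann. of Math. Stud. 123 (1990), §3.9 p. 32, Prop. 3.9.1 (one
  regular unipotent class), §4.9 Prop. 4.9.1 (b) p. 55 (unipotent orbital integrals of the unit).
* [Serre1979] J.-P. Serre, *Local Fields*, GTM 67 (1979), Ch. III §3, §6 Prop. 13 (trace and different of a ramified quadratic extension).
-/

noncomputable section

namespace Summit.HodgeConjecture.HodgeConjecture.Cruxes.H413.F0P3cDyRamTableDiagWitnessReg

open NumberField IsDedekindDomain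
open Literature.NumberTheory.Automorphic Literature.NumberTheory.Automorphic.UnitaryGroup
open Literature.NumberTheory.Automorphic.HermitianLattice Literature.NumberTheory.Automorphic.UnitaryThreeFourFrame
open Literature.NumberTheory.Automorphic.UnitaryLatticeTree
open Literature.NumberTheory.Rogawski1990 Literature.NumberTheory.GaloisRepresentations
open Summit.HodgeConjecture.HodgeConjecture.Cruxes.H413.F0P3cDyRamFourFramePieces
open Summit.HodgeConjecture.HodgeConjecture.Cruxes.H413.F0P3cDyRamWildPlaceDatum
open Summit.HodgeConjecture.HodgeConjecture.Cruxes.H413.F0P3cDyRamDOfPlaceOfDatum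
open Summit.HodgeConjecture.HodgeConjecture.Cruxes.H413.F0P3cDyRamUnipotentLabelInjOn
open scoped Matrix MatrixGroups ValuativeRel WithZero
open WithZero

/-! ## §1 Field level: the integral regular unipotent `u(a, −θ·aσa)` and its square -/

section Field

variable {K : Type*} [Field K] (σ : K →+* K)

/-- `u(a, b) = (1, a, b; 0, 1, −σa; 0, 0, 1)` with `b = −θ·(a·σa)`, `θ + σθ = 1`, lies in `U(σ, J₀)` (`b + σb + aσa = 0`). [cite: Rogawski1990, §1.10 p. 9] -/
theorem upperUnipotent_traceOne_mem (hσ : ∀ z : K, σ (σ z) = z) {θ : K} (hθ : θ + σ θ = 1) (a : K) {g : GL (Fin 3) K}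
    (hg : (g : Matrix (Fin 3) (Fin 3) K) = !![1, a, -(θ * (a * σ a)); 0, 1, -σ a; 0, 0, 1]) :
    g ∈ unitaryGroupOfForm σ ((StdForm.antidiagonal 3).over K) := by
  refine (mem_unitaryGroupOfForm_iff_of_coe_eq_upperUnipotent σ hσ hg).2 ⟨rfl, ?_⟩
  rw [map_neg, map_mul, map_mul, hσ]
  linear_combination (-(a * σ a)) * hθ

/-- `(u(a, b) − 1)³ = 0`. [cite: Rogawski1990, §3.9 p. 32] -/
theorem upperUnipotent_sub_one_pow_three (a b c : K) :
    ((!![1, a, b; 0, 1, c; 0, 0, 1] : Matrix (Fin 3) (Fin 3) K) - 1) ^ 3 = 0 := by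
  rw [pow_succ, pow_two, upperUnipotent_sub_one_mul_self]
  ext i j
  fin_cases i <;> fin_cases j <;> simp [Matrix.mul_apply, Fin.sum_univ_three, Matrix.one_apply]

end Field

/-! ## §2 The regular diagonal witness at a ramified `σ`-stable place -/

section CM

variable (L : Type) [Field L] [NumberField L] [IsCMField L] {v : HeightOneSpectrum (𝓞 ↥(maximalRealSubfield L))}
  (w : UnitaryGroup.PlacesOver L v) (hw : IsCMField.complexConj L • w.1 = w.1)

/-- **THE REGULAR DIAGONAL WITNESS** (REF5 R5-11 (T3), regular entry): every class of `G = U(Φ₃)(L⁺_v)` represented by a regular unipotent meets the support set of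
`f_reg` — some `x ∈ K` with `(wMatrix x − 1)² ∉ ϖ^{m*}·M₃(𝒪_w)` has `ConjClasses.mk x = c` (the integral regular unipotent `u(ϖ^{⌊d∕2⌋}, −θ·N(ϖ^{⌊d∕2⌋}))`, one
regular class). [cite: Rogawski1990, §3.9 Proposition 3.9.1 p. 32; §4.9 Prop. 4.9.1 (b) p. 55] [cite: Serre1979, Ch. III §6 Prop. 13] -/
theorem exists_mem_supportReg_mk_eq (he : v.asIdeal.ramificationIdx' w.1.asIdeal ≠ 1) (ϖ : w.1.adicCompletion L) (hϖ : Valued.v ϖ = WithZero.exp (-1 : ℤ))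
    (c : ConjClasses ((UnitaryGroup.cmDatum L 3 (Matrix.of fun i j : Fin 3 => if i.val + j.val + 1 = 3 then (1 : L) else 0)).Local v))
    (hc3 : ((((Quotient.out c : ((UnitaryGroup.cmDatum L 3 (Matrix.of fun i j : Fin 3 => if i.val + j.val + 1 = 3 then (1 : L) else 0)).Local v)).val :
      GL (Fin 3) (UnitaryGroup.LocalRing L v)).val - 1) ^ 3) = 0)
    (hsq : (wMatrix L w hw (Quotient.out c) - 1) * (wMatrix L w hw (Quotient.out c) - 1) ≠ 0) :
    ∃ x : ((UnitaryGroup.cmDatum L 3 (Matrix.of fun i j : Fin 3 => if i.val + j.val + 1 = 3 then (1 : L) else 0)).Local v),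
      x ∈ {u : ((UnitaryGroup.cmDatum L 3 (Matrix.of fun i j : Fin 3 => if i.val + j.val + 1 = 3 then (1 : L) else 0)).Local v) |
        u ∈ cmLocalIntegralLevel L 3 (Matrix.of fun i j : Fin 3 => if i.val + j.val + 1 = 3 then (1 : L) else 0) v ∧
        ¬ InLevel ϖ (mstarFn L v w) ((wMatrix L w hw u - 1) * (wMatrix L w hw u - 1))} ∧
      ConjClasses.mk x = c := by
  obtain ⟨hσσ, h20⟩ := galAdicCompletionMap_involutive_and_two_ne_zero L w hw
  have hvσ : ∀ a : w.1.adicCompletion L, Valued.v (galAdicCompletionMap (L := L) (IsCMField.complexConj L) hw a) = Valued.v a :=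
    fun a => valued_galAdicCompletionMap (L := L) (IsCMField.complexConj L) hw a
  -- the datum at `w` and its numbers
  obtain ⟨d, t, hD⟩ := exists_isRamifiedQuadraticDatum_of_placesOver L w hw he ϖ hϖ
  have hDd : dOfPlace L v w = d := dOfPlace_eq_of_isRamifiedQuadraticDatum L w hw he hD
  obtain ⟨-, -, -, heven, hd, h1d, h2t⟩ := hD
  have hk : 2 * (d / 2) + d % 2 = d := Nat.div_add_mod d 2
  have hd2 : d % 2 < 2 := Nat.mod_lt d (by norm_num)
  have hϖ0 : ϖ ≠ 0 := fun h => by rw [h, map_zero] at hϖ; exact WithZero.coe_ne_zero hϖ.symm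
  -- the trace-one element `θ`: `θ + σθ = 1`, `|θ| = exp(d − 1)`
  obtain ⟨θ, hθ, hθv⟩ := Literature.NumberTheory.LocalFields.WildQuadraticDatum.exists_traceOne_of_datum hσσ heven hϖ hd h2t
  have hθv' : Valued.v θ = exp ((d : ℤ) - 1) := by
    rw [hϖ, ← exp_nsmul, smul_neg, nsmul_eq_mul, mul_one, ← eq_mul_inv_iff_mul_eq₀ exp_ne_zero, ← exp_neg, ← exp_add, neg_neg] at hθv
    rw [hθv]; congr 1
  -- the witness matrix `g = u(a, b)`, `a = ϖ^k`
  obtain ⟨g, hg, hg'⟩ := exists_units_coe_eq_upperTriangularUnipotent (ϖ ^ (d / 2))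
    (-(θ * (ϖ ^ (d / 2) * galAdicCompletionMap (L := L) (IsCMField.complexConj L) hw (ϖ ^ (d / 2))))) (-galAdicCompletionMap (L := L) (IsCMField.complexConj L) hw (ϖ ^ (d / 2)))
  have hgU := upperUnipotent_traceOne_mem (galAdicCompletionMap (L := L) (IsCMField.complexConj L) hw) hσσ hθ (ϖ ^ (d / 2)) hg
  -- valuations of the entries
  have hva : Valued.v (ϖ ^ (d / 2)) = exp (-((d / 2 : ℕ) : ℤ)) := by rw [map_pow, hϖ, ← exp_nsmul, smul_neg, nsmul_eq_mul, mul_one]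
  have hvσa : Valued.v (galAdicCompletionMap (L := L) (IsCMField.complexConj L) hw (ϖ ^ (d / 2))) = exp (-((d / 2 : ℕ) : ℤ)) := by rw [hvσ, hva]
  have hvb : Valued.v (-(θ * (ϖ ^ (d / 2) * galAdicCompletionMap (L := L) (IsCMField.complexConj L) hw (ϖ ^ (d / 2))))) ≤ 1 := by
    rw [Valuation.map_neg, map_mul, map_mul, hθv', hva, hvσa, ← exp_add, ← exp_add, ← exp_zero, exp_le_exp]; omega
  have hva1 : Valued.v (ϖ ^ (d / 2)) ≤ 1 := by rw [hva, ← exp_zero, exp_le_exp]; omega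
  have hvσa1 : Valued.v (-galAdicCompletionMap (L := L) (IsCMField.complexConj L) hw (ϖ ^ (d / 2))) ≤ 1 := by
    rw [Valuation.map_neg, hvσa, ← exp_zero, exp_le_exp]; omega
  have hv0 : Valued.v (0 : w.1.adicCompletion L) ≤ 1 := by rw [map_zero]; exact zero_le
  have hv1 : Valued.v (1 : w.1.adicCompletion L) ≤ 1 := (map_one _).le
  have hint : IsIntMatrix (g : Matrix (Fin 3) (Fin 3) (w.1.adicCompletion L)) := by
    intro i j
    rw [hg]
    fin_cases i <;> fin_cases j <;>
      simp only [Fin.zero_eta, Fin.mk_one, Fin.reduceFinMk, Fin.isValue, Matrix.of_apply, Matrix.cons_val', Matrix.cons_val_zero, Matrix.cons_val_one,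
        Matrix.cons_val_two, Matrix.empty_val', Matrix.cons_val_fin_one, Matrix.head_cons, Matrix.tail_cons, Matrix.head_fin_const] <;>
      first | exact hva1 | exact hvb | exact hvσa1 | exact hv0 | exact hv1
  have hint' : IsIntMatrix ((g⁻¹ : GL (Fin 3) (w.1.adicCompletion L)) : Matrix (Fin 3) (Fin 3) (w.1.adicCompletion L)) :=
    isIntMatrix_inv_of_mem_unitaryGroupOfForm (galAdicCompletionMap (L := L) (IsCMField.complexConj L) hw) hvσ hgU hint
  -- pull `g` back into `G`
  obtain ⟨x, hx⟩ := exists_conj_localNonsplitEquiv_eq L (Matrix.of fun i j : Fin 3 => if i.val + j.val + 1 = 3 then (1 : L) else 0) v w hw (T := 1)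
    (placeForm_antidiagOne_eq_formCongr_one L w hw) hgU
  rw [one_mul, inv_one, mul_one] at hx
  have hX : wMatrix L w hw x = (g : Matrix (Fin 3) (Fin 3) (w.1.adicCompletion L)) := by
    show (((localNonsplitEquiv (IsCMField.complexConj L) (Matrix.of fun i j : Fin 3 => if i.val + j.val + 1 = 3 then (1 : L) else 0) (IsCMField.complexConj_ne_one L) w hw x :
        ↥(unitaryGroupOfForm (galAdicCompletionMap (L := L) (IsCMField.complexConj L) hw) (placeForm (Matrix.of fun i j : Fin 3 => if i.val + j.val + 1 = 3 then (1 : L) else 0) w.1))) :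
          GL (Fin 3) (w.1.adicCompletion L)) : Matrix (Fin 3) (Fin 3) (w.1.adicCompletion L)) = _
    rw [hx]
  have hsqX : (wMatrix L w hw x - 1) * (wMatrix L w hw x - 1) =
      !![0, 0, ϖ ^ (d / 2) * -galAdicCompletionMap (L := L) (IsCMField.complexConj L) hw (ϖ ^ (d / 2)); 0, 0, 0; 0, 0, 0] := by
    rw [hX, hg, upperUnipotent_sub_one_mul_self]
  refine ⟨x, ⟨?_, ?_⟩, ?_⟩
  · -- `x ∈ K`
    refine (mem_cmLocalIntegralLevel_iff_isIntMatrix L 3 (Matrix.of fun i j : Fin 3 => if i.val + j.val + 1 = 3 then (1 : L) else 0)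
      (IsCMField.complexConj_ne_one L) w hw x).2 ⟨?_, ?_⟩
    · rw [hx]; exact hint
    · rw [hx]; exact hint'
  · -- `X² ∉ ϖ^{m*} M₃(𝒪)`: the `(0,2)` entry has valuation `2k = d − ℓ₀ < m*`
    intro hlev
    have h02 := hlev 0 2
    rw [hsqX, mstarFn, hDd, mstarOfRecord] at h02
    simp only [Matrix.of_apply, Matrix.cons_val', Matrix.cons_val_zero, Matrix.cons_val_two, Matrix.empty_val', Matrix.cons_val_fin_one,
      Matrix.tail_cons, Matrix.head_cons] at h02
    rw [map_mul, map_mul, Valuation.map_neg, map_inv₀, map_pow, hϖ, hva, hvσa, ← exp_nsmul, smul_neg, nsmul_eq_mul, mul_one, ← exp_neg, neg_neg,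
      ← exp_add, ← exp_add, ← exp_zero, exp_le_exp] at h02
    omega
  · -- `x ~ out c`: one regular class
    have hnil : IsNilpotent ((g : Matrix (Fin 3) (Fin 3) (w.1.adicCompletion L)) - 1) := ⟨3, by rw [hg]; exact upperUnipotent_sub_one_pow_three _ _ _⟩
    have hreg : ((g : Matrix (Fin 3) (Fin 3) (w.1.adicCompletion L)) - 1) * ((g : Matrix (Fin 3) (Fin 3) (w.1.adicCompletion L)) - 1) ≠ 0 := by
      rw [← hX, hsqX]
      intro h0
      have h02 := congrFun (congrFun h0 0) 2
      simp only [Matrix.of_apply, Matrix.cons_val', Matrix.cons_val_zero, Matrix.cons_val_two, Matrix.empty_val', Matrix.cons_val_fin_one,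
        Matrix.tail_cons, Matrix.head_cons, Matrix.zero_apply, mul_neg, neg_eq_zero, mul_eq_zero] at h02
      rcases h02 with h | h
      · exact pow_ne_zero _ hϖ0 h
      · exact pow_ne_zero _ hϖ0 ((map_eq_zero _).1 h)
    obtain ⟨k, hk, hkN⟩ := exists_conj_coe_eq_regularUnipotentNormalForm (galAdicCompletionMap (L := L) (IsCMField.complexConj L) hw) hσσ h20
      (F0P3cDyRamProfilePiecesProps.coe_mem_unitaryGroupOfForm_over L w hw (Quotient.out c)) ⟨3, wMatrix_sub_one_pow_eq_zero L w hw hc3⟩ hsq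
    obtain ⟨k', hk', hkN'⟩ := exists_conj_coe_eq_regularUnipotentNormalForm (galAdicCompletionMap (L := L) (IsCMField.complexConj L) hw) hσσ h20 hgU hnil hreg
    have hconj : IsConj (Quotient.out c) x := by
      refine isConj_of_conj_conj_eq L w hw hk hk' (one_mem _) ?_
      rw [one_mul, inv_one, mul_one, hx]
      exact Units.ext (hkN.trans hkN'.symm)
    rw [← Quotient.out_eq c, ConjClasses.quotient_mk_eq_mk]
    exact (ConjClasses.mk_eq_mk_iff_isConj.2 hconj).symm

end CM

end Summit.HodgeConjecture.HodgeConjecture.Cruxes.H413.F0P3cDyRamTableDiagWitnessReg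

end
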